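import Summits.AnomalousDissipation.AnomalousDissipation.Theorems.BaireTransferDenseLoudDesignerForcesErgodicConjugatedMildIdentity
import Summits.AnomalousDissipation.AnomalousDissipation.Theorems.BaireTransferDenseLoudDesignerForcesErgodicModelDefs
import Literature.Analysis.FluidPDE.TorusLinearisedNSModeDuhamel

/-!
# A classical linearised trajectory read in the frame `S = (1 + A)^{-1/2}` solves the linear mild equation
# (line `ergodic-budget-selection-closing`, crux `BaireTransfer.DenseLoudDesignerForces`,
# stmt-AnomalousDissipation-1143) — tools stub L1 of block N

Sorry-free file, the LINEAR TWIN of `…ErgodicConjugatedMildIdentity.lean` (tools stub S5b, whose coefficient lemmas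
`inner_basis_apply_of_apply_basis`, `inner_stateOf_right_of_coe_eq`, `eq_frame_apply_of_frame_apply_eq_stateOf`,
`continuousOn_stateOf_of_isSmoothSpaceTimeOn` are reused by import), over the ACCEPTED frame vocabulary `ModelFrame`
(`…ErgodicModelDefs.lean`: the Stokes mode basis `b` with eigenvalues `m`, the diagonal operators `S = diag((1 + m)^{-1/2})`,
`T t = diag(e^{-tm})`, `K t = diag(m^{3/4} e^{-tm})` and the bounded bilinear form `Nb` with the coefficient formula
`⟪Nb y z, b i⟫ = −m_i^{-3/4} (1 + m_i)^{1/2} ∫⟪rep (S z), (rep (S y)·∇)φ_i⟫`), the linearised equation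
`IsLinearizedNSSolutionOn` of `…ErgodicLine.lean` §2, the landed modewise Duhamel formula of the (forced) linearised
equation `linearisedNSForced_integral_inner_eq_exp_mul_add_integral` (`Literature/Analysis/FluidPDE/TorusLinearisedNSModeDuhamel.lean`,
specialised to zero forcing) and the integrability of weakly singular Duhamel integrands
(`Literature/Analysis/UnboundedOperators/WeaklySingularDuhamel.lean`).

Block N of the line identifies the derivative of the smooth model along a model trajectory with the LINEAR mild flow
`z(t) = T(νt) z₀ − ∫₀ᵗ K(ν(t − s)) (Nb(y(s), z(s)) + Nb(z(s), y(s))) ds` driven by the frame curve `y` of the background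
(`S (y t) = [u(a₀ + t)]`).  This file proves that the FRAME CURVE `z` of a classical solution `(w, q)` of the linearised
system `∂ₜw + (u·∇)w + (w·∇)u = νΔw − ∇q` along `u`, `S (z t) = [w(a₀ + t)]`, solves exactly this equation
(`stub_conjugatedLinearisedMildIdentityTools`, the REGISTERED tools stub L1), through:

* `ModelFrame.continuousOn_frameCurve` — the frame curve `x`, `S (x t) = [v(a₀ + t)]`, of ANY jointly smooth field `v`
  with divergence-free mean-zero slices is continuous on the window (`x t = S([v] − [Δv])(a₀ + t)` by
  `eq_frame_apply_of_frame_apply_eq_stateOf`, and state curves of jointly smooth honest fields are continuous); applied to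
  the background `u` and to `w` it makes the symmetrised Duhamel integrand Bochner integrable
  (`ModelFrame.intervalIntegrable_linearisedDuhamelIntegrand`: `intervalIntegrable_duhamelIntegrand`, exponent `3/4`);
* `ModelFrame.inner_basis_nb_eq` — the coefficient of `Nb` at frame preimages of honest states, `S x₁ = [v₁]`, `S x₂ = [v₂]`:
  `⟪b i, Nb x₁ x₂⟫ = −m_i^{-3/4} (1 + m_i)^{1/2} ∫⟪v₂, (v₁·∇)φ_i⟫` (`rep (S x_j) = v_j` a.e.; first slot = advecting field);
* `integral_inner_stokesMode_eq_of_isLinearizedNSSolutionOn` — the modewise linearised Duhamel formula on the window with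
  the symmetrised source `∫⟪w, (u·∇)φ⟫ + ∫⟪u, (w·∇)φ⟫` (zero forcing; antisymmetry `∫⟪(w·∇)u, φ⟫ = −∫⟪u, (w·∇)φ⟫` for the
  divergence-free `w`; change of variables `s ↦ a₀ + s`);
* `ModelFrame.inner_basis_frameCurve_eq_inner_basis_linearisedMild` — coefficientwise the identity is `(1 + m_i)^{1/2}`
  times that formula: `⟪b i, z s⟫ = (1 + m_i)^{1/2} ∫⟪w(a₀ + s), φ_i⟫`, `⟪b i, T r x⟫ = e^{-r m_i}⟪b i, x⟫`,
  `⟪b i, K r x⟫ = m_i^{3/4} e^{-r m_i}⟪b i, x⟫`, `⟪b i, Nb (y s) (z s)⟫ + ⟪b i, Nb (z s) (y s)⟫ =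
  −m_i^{-3/4} (1 + m_i)^{1/2} (∫⟪w, (u·∇)φ_i⟫ + ∫⟪u, (w·∇)φ_i⟫)(a₀ + s)`, and `⟪b i, ∫⟫ = ∫⟪b i, ·⟫`
  (`inner_intervalIntegral_eq_of_intervalIntegrable`);
* `stub_conjugatedLinearisedMildIdentityTools` — vectors with equal basis coefficients are equal (`b.repr` is injective).

References: P. Constantin, C. Foias, *Navier–Stokes Equations* (Chicago 1988), Ch. 14 (14.2)–(14.4) (the linearised flow
and its mild form), Ch. 6 (6.9)–(6.10) (the bilinear term); D. Henry, *Geometric Theory of Semilinear Parabolic Equations*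
(1981), §3.3 and Ch. 8.  Nothing is asserted; no definition is added.
-/

-- `Summit.<Summit>.<Problem>` is the tree's mandated summit-side namespace (CONVENTIONS §2); for this
-- single-conjunct summit the two coincide, so the duplicate is deliberate.
set_option linter.dupNamespace false

noncomputable section

open Set Function MeasureTheory Filter
open scoped InnerProductSpace RealInnerProductSpace Topology

namespace Summit.AnomalousDissipation.AnomalousDissipation.Theorems.DenseLoudDesignerForces.Ergodic

open Literature.Analysis.FunctionSpaces Literature.Analysis.FunctionSpaces.Torus
open Literature.Analysis.FluidPDE Literature.Analysis.FluidPDE.Torus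

/-! ## Frame curves of jointly smooth honest fields and the symmetrised Duhamel integrand -/

/-- **The frame curve of a jointly smooth honest field is continuous.**  Over a `ModelFrame`, if `S (x t) = [v(a₀ + t)]`
on `[0, τ']` for a field `v` jointly smooth on `[a₀, a₀ + τ'] × T³` with divergence-free mean-zero slices, then `x` is
continuous on `[0, τ']`: `x t = S ([v] − [Δv])(a₀ + t)` (`eq_frame_apply_of_frame_apply_eq_stateOf`) and the state curves
of the jointly smooth honest fields `v`, `Δv` are continuous (`continuousOn_stateOf_of_isSmoothSpaceTimeOn`) — the
`V`-continuity of smooth curves read through `S⁻¹ = (1 + A)^{1/2}` (Constantin–Foias 1988, Ch. 4 (4.11)–(4.13)); the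
classical-solution case is S5b's `continuousOn_frameCurve`. [folklore] -/
theorem ModelFrame.continuousOn_frameCurve (F : ModelFrame) {a₀ τ' : ℝ} (hτ' : 0 < τ')
    {v : ℝ → (UnitAddTorus (Fin 3)) → (EuclideanSpace ℝ (Fin 3))} (hv : IsSmoothSpaceTimeOn (Icc a₀ (a₀ + τ')) v)
    (hd : ∀ t ∈ Icc a₀ (a₀ + τ'), IsDivFree (v t)) (hm : ∀ t ∈ Icc a₀ (a₀ + τ'), HasZeroMean (v t))
    {x : ℝ → Hsp} (hx : ∀ t ∈ Icc (0 : ℝ) τ', F.S (x t) = stateOf (v (a₀ + t))) : ContinuousOn x (Icc 0 τ') := by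
  have hU : UniqueDiffOn ℝ (Icc a₀ (a₀ + τ')) := uniqueDiffOn_Icc (by linarith)
  have hvs : ∀ s ∈ Icc a₀ (a₀ + τ'), IsSmooth (v s) := fun s hs => hv.isSmooth_slice hs
  have hI : ∀ s ∈ Icc (0 : ℝ) τ', a₀ + s ∈ Icc a₀ (a₀ + τ') := fun s hs =>
    ⟨by linarith [hs.1], by linarith [hs.2]⟩
  have hW : ContinuousOn (fun s => stateOf (v s) - stateOf (laplacian (v s))) (Icc a₀ (a₀ + τ')) :=
    (continuousOn_stateOf_of_isSmoothSpaceTimeOn hv hd hm).sub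
      (continuousOn_stateOf_of_isSmoothSpaceTimeOn (hv.laplacian hU)
        (fun s hs => IsDivFree.laplacian_of_isSmooth (hvs s hs) (hd s hs))
        (fun s hs => integral_laplacian_eq_zero_of_isSmooth (hvs s hs)))
  have h1 : ContinuousOn (fun s => F.S (stateOf (v (a₀ + s)) - stateOf (laplacian (v (a₀ + s))))) (Icc 0 τ') :=
    F.S.continuous.comp_continuousOn (hW.comp (continuous_const.add continuous_id).continuousOn hI)
  refine h1.congr fun s hs => ?_
  exact eq_frame_apply_of_frame_apply_eq_stateOf F.b F.hmodes F.hS (hvs _ (hI s hs)) (hd _ (hI s hs)) (hm _ (hI s hs))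
    (hx s hs)

/-- **The symmetrised Duhamel integrand of two continuous curves is integrable.**  Over a `ModelFrame`, for `ν > 0` and
curves `y`, `z` continuous on `[0, τ']`, the integrand `s ↦ K(ν(t − s)) (Nb (y s) (z s) + Nb (z s) (y s))` is interval
integrable on `[0, t]` for `t ∈ [0, τ']`: the kernel `K(ν·)` is weakly singular, `‖K(νr)‖ ≤ ν^{-3/4} r^{-3/4}`
(`ModelFrame.hKnorm`), strongly continuous on `(0, ∞)`, and the source is continuous (continuous extensions of `y`, `z`
off the window; `intervalIntegrable_duhamelIntegrand`, exponent `3/4 < 1`) (Henry 1981, §3.3; Pazy 1983, proof of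
Thm. 6.3.1). [folklore] -/
theorem ModelFrame.intervalIntegrable_linearisedDuhamelIntegrand (F : ModelFrame) {ν : ℝ} (hν : 0 < ν) {τ' : ℝ}
    (hτ' : 0 < τ') {y z : ℝ → Hsp} (hyc : ContinuousOn y (Icc 0 τ')) (hzc : ContinuousOn z (Icc 0 τ')) {t : ℝ}
    (ht : t ∈ Icc (0 : ℝ) τ') :
    IntervalIntegrable (fun s => F.K (ν * (t - s)) (F.Nb (y s) (z s) + F.Nb (z s) (y s))) volume 0 t := by
  have ht0 : (0 : ℝ) ≤ t := ht.1
  -- continuous extensions of the two curves off the window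
  have hey : ∃ yx : ℝ → Hsp, Continuous yx ∧ ∀ s ∈ Icc (0 : ℝ) τ', yx s = y s :=
    ⟨IccExtend hτ'.le ((Icc (0 : ℝ) τ').restrict y), (continuousOn_iff_continuous_restrict.1 hyc).Icc_extend',
      fun s hs => IccExtend_of_mem hτ'.le _ hs⟩
  have hez : ∃ zx : ℝ → Hsp, Continuous zx ∧ ∀ s ∈ Icc (0 : ℝ) τ', zx s = z s :=
    ⟨IccExtend hτ'.le ((Icc (0 : ℝ) τ').restrict z), (continuousOn_iff_continuous_restrict.1 hzc).Icc_extend',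
      fun s hs => IccExtend_of_mem hτ'.le _ hs⟩
  obtain ⟨yx, hyx, hyxeq⟩ := hey
  obtain ⟨zx, hzx, hzxeq⟩ := hez
  have hg : Continuous fun s => F.Nb (yx s) (zx s) + F.Nb (zx s) (yx s) :=
    (F.Nb.continuous₂.comp₂ hyx hzx).add (F.Nb.continuous₂.comp₂ hzx hyx)
  -- the weakly singular kernel `K(ν·)`, exponent `3/4`, applied to the continuous source
  have hK' : ∀ r, 0 < r → ‖F.K (ν * r)‖ ≤ ν ^ (-(3 / 4 : ℝ)) * r ^ (-(3 / 4 : ℝ)) := fun r hr =>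
    (F.hKnorm (ν * r) (mul_pos hν hr)).trans_eq (Real.mul_rpow hν.le hr.le)
  have hK'c : ∀ x : Hsp, ContinuousOn (fun r : ℝ => F.K (ν * r) x) (Ioi 0) := fun x =>
    (F.hKc x).comp (continuous_const.mul continuous_id).continuousOn fun r hr => mul_pos hν hr
  have h := Literature.Analysis.UnboundedOperators.intervalIntegrable_duhamelIntegrand (K := fun r => F.K (ν * r))
    hK' hK'c (by norm_num : (3 / 4 : ℝ) < 1) hg ht0
  refine h.congr fun s hs => ?_
  rw [uIoc_of_le ht0] at hs
  have hs' : s ∈ Icc (0 : ℝ) τ' := ⟨hs.1.le, hs.2.trans ht.2⟩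
  simp only [hyxeq s hs', hzxeq s hs']

/-- `⟪c, ∫₀ᵗ f⟫ = ∫₀ᵗ ⟪c, f⟫` for an interval-integrable `Hsp`-valued `f` and `0 ≤ t` (`integral_inner`: a continuous
linear functional commutes with the Bochner integral). [folklore] -/
theorem inner_intervalIntegral_eq_of_intervalIntegrable {f : ℝ → Hsp} {t : ℝ} (ht : 0 ≤ t)
    (hf : IntervalIntegrable f volume 0 t) (c : Hsp) :
    ⟪c, ∫ s in (0 : ℝ)..t, f s⟫_ℝ = ∫ s in (0 : ℝ)..t, ⟪c, f s⟫_ℝ := by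
  simp only [intervalIntegral.integral_of_le ht]
  exact (integral_inner hf.1 c).symm

/-! ## Mode coefficients: the bilinear form at frame preimages, and the linearised Duhamel formula on the window -/

/-- **The coefficient of the bilinear form at frame preimages of honest states.**  Over a `ModelFrame`, along a basis
mode `b i = [φ]` (`φ = stokesMode k a c`), if `S x₁ = [v₁]` and `S x₂ = [v₂]` for smooth divergence-free mean-zero
fields then `⟪b i, Nb x₁ x₂⟫ = −m_i^{-3/4} (1 + m_i)^{1/2} ∫⟪v₂, (v₁·∇)φ⟫`: the coefficient formula `ModelFrame.hNb`
with the representatives `rep (S x₁) = v₁`, `rep (S x₂) = v₂` a.e. (`rep_stateOf`; `((a·∇)φ)(x)` depends on `a x` only)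
— the first slot of `Nb` is the ADVECTING field (Constantin–Foias 1988, Ch. 6 (6.9)–(6.10)). [folklore] -/
theorem ModelFrame.inner_basis_nb_eq (F : ModelFrame) {i : F.ι} {k : Fin 3 → ℤ} {a : EuclideanSpace ℝ (Fin 3)}
    {c : Bool} (hbi : ((F.b i : Hsp) : Lp (EuclideanSpace ℝ (Fin 3)) 2 (volume : Measure (UnitAddTorus (Fin 3)))) =
      stokesModeL2 k a c)
    {v₁ v₂ : (UnitAddTorus (Fin 3)) → (EuclideanSpace ℝ (Fin 3))} (h₁ : IsSmooth v₁) (hd₁ : IsDivFree v₁)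
    (hm₁ : HasZeroMean v₁) (h₂ : IsSmooth v₂) (hd₂ : IsDivFree v₂) (hm₂ : HasZeroMean v₂) {x₁ x₂ : Hsp}
    (hx₁ : F.S x₁ = stateOf v₁) (hx₂ : F.S x₂ = stateOf v₂) :
    ⟪F.b i, F.Nb x₁ x₂⟫_ℝ = -((F.m i) ^ (-(3 / 4 : ℝ)) * (1 + F.m i) ^ (1 / 2 : ℝ)) *
      ∫ x, ⟪v₂ x, convect v₁ ⇑(stokesMode k a c) x⟫_ℝ := by
  rw [real_inner_comm (F.Nb x₁ x₂) (F.b i), F.hNb x₁ x₂ i k a c hbi, hx₁, hx₂]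
  congr 1
  refine integral_congr_ae ?_
  filter_upwards [rep_stateOf h₁ hd₁ hm₁, rep_stateOf h₂ hd₂ hm₂] with x hx₁' hx₂'
  simp only [Torus.convect, hx₁', hx₂']

/-- **The modewise Duhamel formula of the linearised equation on the window, with the symmetrised source.**  For a
jointly smooth divergence-free background `u` on `[a₀, a₀ + τ'] × T³`, a classical solution `(w, q)` of the linearised
system `∂ₜw + (u·∇)w + (w·∇)u = νΔw − ∇q` (`IsLinearizedNSSolutionOn`) and a Stokes mode `φ = stokesMode k a c`
(`⟪k, a⟫ = 0`, `Δφ = −4π²|k|² φ`), for `0 ≤ t ≤ τ'`: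
`∫⟪w(a₀+t), φ⟫ = e^{-νt·4π²|k|²} ∫⟪w(a₀), φ⟫ + ∫₀ᵗ e^{-ν(t−s)·4π²|k|²} (∫⟪w, (u·∇)φ⟫ + ∫⟪u, (w·∇)φ⟫)(a₀+s) ds` —
the landed forced formula `linearisedNSForced_integral_inner_eq_exp_mul_add_integral` with zero forcing, the
antisymmetry `∫⟪(w·∇)u, φ⟫ = −∫⟪u, (w·∇)φ⟫` for the divergence-free `w` (`integral_inner_convect_eq_neg`) and the
change of variables `s ↦ a₀ + s` (Constantin–Foias 1988, Ch. 14 (14.2)–(14.4)). [cite: ConstantinFoiasNSE1988, Ch. 14 (14.2)–(14.4)] -/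
theorem integral_inner_stokesMode_eq_of_isLinearizedNSSolutionOn {ν a₀ τ' : ℝ}
    {u w : ℝ → (UnitAddTorus (Fin 3)) → (EuclideanSpace ℝ (Fin 3))} {q : ℝ → (UnitAddTorus (Fin 3)) → ℝ}
    (hu : IsSmoothSpaceTimeOn (Icc a₀ (a₀ + τ')) u) (hudiv : ∀ t ∈ Icc a₀ (a₀ + τ'), IsDivFree (u t))
    (hlin : IsLinearizedNSSolutionOn (Icc a₀ (a₀ + τ')) ν u w q)
    {k : Fin 3 → ℤ} {a : EuclideanSpace ℝ (Fin 3)} (hka : ⟪latticeVec k, a⟫_ℝ = 0) (c : Bool)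
    {t : ℝ} (ht0 : 0 ≤ t) (htτ : t ≤ τ') :
    ∫ x, ⟪w (a₀ + t) x, stokesMode k a c x⟫_ℝ =
      Real.exp (-(ν * t * stokesEigenvalue k)) * (∫ x, ⟪w a₀ x, stokesMode k a c x⟫_ℝ) +
        ∫ s in (0 : ℝ)..t, Real.exp (-(ν * (t - s) * stokesEigenvalue k)) *
          ((∫ x, ⟪w (a₀ + s) x, convect (u (a₀ + s)) ⇑(stokesMode k a c) x⟫_ℝ) +
            ∫ x, ⟪u (a₀ + s) x, convect (w (a₀ + s)) ⇑(stokesMode k a c) x⟫_ℝ) := by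
  obtain ⟨hw, hq, hwdiv, -, heqn⟩ := hlin
  have hus : ∀ s ∈ Icc a₀ (a₀ + τ'), IsSmooth (u s) := fun s hs => hu.isSmooth_slice hs
  have hws : ∀ s ∈ Icc a₀ (a₀ + τ'), IsSmooth (w s) := fun s hs => hw.isSmooth_slice hs
  have hφs : IsSmooth ⇑(stokesMode k a c) := isSmooth_stokesMode k a c
  have hφd : IsDivFree ⇑(stokesMode k a c) := isDivFree_stokesMode hka c
  have heig : ∀ x, laplacian ⇑(stokesMode k a c) x = -(stokesEigenvalue k • stokesMode k a c x) := fun x => by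
    rw [laplacian_stokesMode, neg_smul]
  -- the linearised equation with zero forcing, and its modewise Duhamel formula on `[a₀, a₀ + t]`
  have heqn0 : ∀ s ∈ Icc a₀ (a₀ + τ'), ∀ x, Torus.timeDerivWithin (Icc a₀ (a₀ + τ')) w s x + convect (u s) (w s) x +
      convect (w s) (u s) x = ν • laplacian (w s) x - Torus.gradient (q s) x + 0 := fun s hs x => by
    rw [add_zero]
    exact heqn s hs x
  have hD := linearisedNSForced_integral_inner_eq_exp_mul_add_integral
    (g := fun (_ : ℝ) (_ : UnitAddTorus (Fin 3)) => (0 : EuclideanSpace ℝ (Fin 3))) hu hudiv hw hq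
    (isSmoothSpaceTimeOn_const (isSmooth_const _) _) heqn0 hφs hφd heig
    (show a₀ + t ∈ Icc a₀ (a₀ + τ') from ⟨by linarith, by linarith⟩)
  -- the symmetrised source (antisymmetry of `(w·∇)` for the divergence-free `w`) and the change of variables
  have hex : ∃ G : ℝ → ℝ, ∀ s, G s = Real.exp (-(ν * stokesEigenvalue k * (a₀ + t - s))) *
      ((∫ x, ⟪w s x, convect (u s) ⇑(stokesMode k a c) x⟫_ℝ) + ∫ x, ⟪u s x, convect (w s) ⇑(stokesMode k a c) x⟫_ℝ) :=
    ⟨_, fun s => rfl⟩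
  obtain ⟨G, hG⟩ := hex
  have hat : a₀ ≤ a₀ + t := by linarith
  have hGeq : EqOn (fun s => Real.exp (-(ν * stokesEigenvalue k * (a₀ + t - s))) *
      ((∫ x, ⟪w s x, convect (u s) ⇑(stokesMode k a c) x⟫_ℝ) - (∫ x, ⟪convect (w s) (u s) x, stokesMode k a c x⟫_ℝ) +
        ∫ x, ⟪(fun (_ : ℝ) (_ : UnitAddTorus (Fin 3)) => (0 : EuclideanSpace ℝ (Fin 3))) s x, stokesMode k a c x⟫_ℝ))
      G (uIcc a₀ (a₀ + t)) := by
    intro s hs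
    rw [uIcc_of_le hat] at hs
    have hs' : s ∈ Icc a₀ (a₀ + τ') := ⟨hs.1, hs.2.trans (by linarith)⟩
    dsimp only
    rw [hG, integral_inner_convect_eq_neg (hws s hs') (hwdiv s hs') (hus s hs') hφs]
    simp only [inner_zero_left, integral_zero, add_zero, sub_neg_eq_add]
  have hGeq' : EqOn (fun s => Real.exp (-(ν * (t - s) * stokesEigenvalue k)) *
      ((∫ x, ⟪w (a₀ + s) x, convect (u (a₀ + s)) ⇑(stokesMode k a c) x⟫_ℝ) +
        ∫ x, ⟪u (a₀ + s) x, convect (w (a₀ + s)) ⇑(stokesMode k a c) x⟫_ℝ)) (fun s => G (a₀ + s)) (uIcc 0 t) := by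
    intro s _
    dsimp only
    rw [hG, show -(ν * stokesEigenvalue k * (a₀ + t - (a₀ + s))) = -(ν * (t - s) * stokesEigenvalue k) by ring]
  have hcv : ∫ s in (0 : ℝ)..t, G (a₀ + s) = ∫ s in a₀..a₀ + t, G s := by
    have h := intervalIntegral.integral_comp_add_left G a₀ (a := 0) (b := t)
    rwa [add_zero] at h
  have hE₀ : Real.exp (-(ν * stokesEigenvalue k * (a₀ + t - a₀))) = Real.exp (-(ν * t * stokesEigenvalue k)) :=
    congrArg Real.exp (by ring)
  rw [intervalIntegral.integral_congr hGeq', hcv, ← intervalIntegral.integral_congr hGeq, ← hE₀]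
  exact hD

/-! ## The conjugated linear mild identity along one basis mode -/

/-- **The conjugated linear mild identity along one basis mode.**  In the setting of
`stub_conjugatedLinearisedMildIdentityTools`, with the symmetrised Duhamel integrand known to be integrable on `[0, t]`,
the coefficient of the frame curve `z` along `b i = [φ]` (`φ = stokesMode k a c`, `m i = 4π²|k|²`) satisfies
`⟪b i, z t⟫ = ⟪b i, T(νt) z 0⟫ − ⟪b i, ∫₀ᵗ K(ν(t−s)) (Nb (y s) (z s) + Nb (z s) (y s)) ds⟫`: with `ρ = (1 + m_i)^{1/2}`,
`⟪b i, z s⟫ = ρ ∫⟪w(a₀+s), φ⟫`, `⟪b i, T r x⟫ = e^{-r m_i}⟪b i, x⟫`, `⟪b i, K r x⟫ = m_i^{3/4} e^{-r m_i}⟪b i, x⟫` (diagonal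
actions on the basis), `⟪b i, Nb (y s) (z s)⟫ = −m_i^{-3/4} ρ ∫⟪w(a₀+s), (u(a₀+s)·∇)φ⟫`,
`⟪b i, Nb (z s) (y s)⟫ = −m_i^{-3/4} ρ ∫⟪u(a₀+s), (w(a₀+s)·∇)φ⟫` (`ModelFrame.inner_basis_nb_eq`), `⟪b i, ∫⟫ = ∫⟪b i, ·⟫`
(`inner_intervalIntegral_eq_of_intervalIntegrable`); the identity is `ρ` times the modewise linearised Duhamel formula
on the window `integral_inner_stokesMode_eq_of_isLinearizedNSSolutionOn` (Constantin–Foias 1988, Ch. 14 (14.2)–(14.4)).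
[cite: ConstantinFoiasNSE1988, Ch. 14 (14.2)–(14.4)] -/
theorem ModelFrame.inner_basis_frameCurve_eq_inner_basis_linearisedMild (F : ModelFrame) {ν : ℝ} (hν : 0 < ν)
    {a₀ τ' : ℝ} {u w : ℝ → (UnitAddTorus (Fin 3)) → (EuclideanSpace ℝ (Fin 3))} {q : ℝ → (UnitAddTorus (Fin 3)) → ℝ}
    (hu : IsSmoothSpaceTimeOn (Icc a₀ (a₀ + τ')) u) (hudiv : ∀ t ∈ Icc a₀ (a₀ + τ'), IsDivFree (u t))
    (humean : ∀ t ∈ Icc a₀ (a₀ + τ'), HasZeroMean (u t)) (hlin : IsLinearizedNSSolutionOn (Icc a₀ (a₀ + τ')) ν u w q)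
    {y : ℝ → Hsp} (hy : ∀ t ∈ Icc (0 : ℝ) τ', F.S (y t) = stateOf (u (a₀ + t)))
    {z : ℝ → Hsp} (hz : ∀ t ∈ Icc (0 : ℝ) τ', F.S (z t) = stateOf (w (a₀ + t)))
    {t : ℝ} (ht : t ∈ Icc (0 : ℝ) τ')
    (hI : IntervalIntegrable (fun s => F.K (ν * (t - s)) (F.Nb (y s) (z s) + F.Nb (z s) (y s))) volume 0 t) (i : F.ι) :
    ⟪F.b i, z t⟫_ℝ = ⟪F.b i, F.T (ν * t) (z 0)⟫_ℝ -
      ⟪F.b i, ∫ s in (0 : ℝ)..t, F.K (ν * (t - s)) (F.Nb (y s) (z s) + F.Nb (z s) (y s))⟫_ℝ := by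
  have ht0 : (0 : ℝ) ≤ t := ht.1
  have hus : ∀ s ∈ Icc a₀ (a₀ + τ'), IsSmooth (u s) := fun s hs => hu.isSmooth_slice hs
  have hws : ∀ s ∈ Icc a₀ (a₀ + τ'), IsSmooth (w s) := fun s hs => hlin.1.isSmooth_slice hs
  have hwdiv : ∀ s ∈ Icc a₀ (a₀ + τ'), IsDivFree (w s) := hlin.2.2.1
  have hwmean : ∀ s ∈ Icc a₀ (a₀ + τ'), HasZeroMean (w s) := hlin.2.2.2.1
  have hIw : ∀ s ∈ Icc (0 : ℝ) τ', a₀ + s ∈ Icc a₀ (a₀ + τ') := fun s hs =>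
    ⟨by linarith [hs.1], by linarith [hs.2]⟩
  -- the mode `b i = [φ]`, `φ = stokesMode k a c`, `m i = 4π²|k|²`, and `ρ = (1 + m i)^{1/2}`
  have hmode := F.hmodes i
  obtain ⟨k, a, c, -, -, hka, hbi, hmi⟩ := hmode
  have hm0 : 0 < F.m i := F.hpos i
  have h1 : 0 < 1 + F.m i := by linarith
  have hex : ∃ ρ : ℝ, ρ = (1 + F.m i) ^ (1 / 2 : ℝ) := ⟨_, rfl⟩
  obtain ⟨ρ, hρ⟩ := hex
  have hρ0 : ρ ≠ 0 := hρ ▸ (Real.rpow_pos_of_pos h1 _).ne'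
  have hσρ : (1 + F.m i) ^ (-(1 / 2 : ℝ)) = ρ⁻¹ := hρ ▸ Real.rpow_neg h1.le _
  have hmm : (F.m i) ^ (3 / 4 : ℝ) * (F.m i) ^ (-(3 / 4 : ℝ)) = 1 := by
    rw [Real.rpow_neg hm0.le, mul_inv_cancel₀ (Real.rpow_pos_of_pos hm0 _).ne']
  -- coefficients of the diagonal operators `S`, `T r`, `K r` along `b i`
  have hSi : ∀ x : Hsp, ⟪F.b i, F.S x⟫_ℝ = ρ⁻¹ * ⟪F.b i, x⟫_ℝ := fun x => by
    rw [inner_basis_apply_of_apply_basis F.b F.hS x i, hσρ]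
  have hTi : ∀ r : ℝ, 0 ≤ r → ∀ x : Hsp, ⟪F.b i, F.T r x⟫_ℝ = Real.exp (-(r * F.m i)) * ⟪F.b i, x⟫_ℝ :=
    fun r hr x => inner_basis_apply_of_apply_basis F.b (fun j => F.hT r j hr) x i
  have hKi : ∀ r : ℝ, 0 < r → ∀ x : Hsp,
      ⟪F.b i, F.K r x⟫_ℝ = ((F.m i) ^ (3 / 4 : ℝ) * Real.exp (-(r * F.m i))) * ⟪F.b i, x⟫_ℝ := fun r hr x =>
    inner_basis_apply_of_apply_basis F.b (fun j => F.hK r j hr) x i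
  -- the frame curve `z` along `b i`
  have hzi : ∀ s ∈ Icc (0 : ℝ) τ', ⟪F.b i, z s⟫_ℝ = ρ * ∫ x, ⟪w (a₀ + s) x, stokesMode k a c x⟫_ℝ := by
    intro s hs
    have h := hSi (z s)
    rw [hz s hs, inner_stateOf_right_of_coe_eq (hws _ (hIw s hs)) (hwdiv _ (hIw s hs)) (hwmean _ (hIw s hs)) hbi] at h
    rw [h, ← mul_assoc, mul_inv_cancel₀ hρ0, one_mul]
  -- the modewise linearised Duhamel formula on the window, in terms of `m i`
  have hD := integral_inner_stokesMode_eq_of_isLinearizedNSSolutionOn hu hudiv hlin hka c ht0 ht.2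
  rw [← hmi] at hD
  -- the symmetrised Duhamel integrand along `b i`, for a.e. `s ∈ (0, t]`
  have hae : ∀ᵐ s ∂volume, s ∈ uIoc (0 : ℝ) t →
      ⟪F.b i, F.K (ν * (t - s)) (F.Nb (y s) (z s) + F.Nb (z s) (y s))⟫_ℝ =
        -ρ * (Real.exp (-(ν * (t - s) * F.m i)) *
          ((∫ x, ⟪w (a₀ + s) x, convect (u (a₀ + s)) ⇑(stokesMode k a c) x⟫_ℝ) +
            ∫ x, ⟪u (a₀ + s) x, convect (w (a₀ + s)) ⇑(stokesMode k a c) x⟫_ℝ)) := by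
    filter_upwards [compl_mem_ae_iff.mpr (Real.volume_singleton (a := t))] with s hst hs
    rw [uIoc_of_le ht0] at hs
    have hlt : s < t := lt_of_le_of_ne hs.2 hst
    have hs' : s ∈ Icc (0 : ℝ) τ' := ⟨hs.1.le, hs.2.trans ht.2⟩
    have hs'' : a₀ + s ∈ Icc a₀ (a₀ + τ') := hIw s hs'
    rw [hKi _ (mul_pos hν (sub_pos.2 hlt)) _, inner_add_right,
      F.inner_basis_nb_eq hbi (hus _ hs'') (hudiv _ hs'') (humean _ hs'') (hws _ hs'') (hwdiv _ hs'') (hwmean _ hs'')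
        (hy s hs') (hz s hs'),
      F.inner_basis_nb_eq hbi (hws _ hs'') (hwdiv _ hs'') (hwmean _ hs'') (hus _ hs'') (hudiv _ hs'') (humean _ hs'')
        (hz s hs') (hy s hs'), ← hρ]
    linear_combination -(Real.exp (-(ν * (t - s) * F.m i)) * ρ *
      ((∫ x, ⟪w (a₀ + s) x, convect (u (a₀ + s)) ⇑(stokesMode k a c) x⟫_ℝ) +
        ∫ x, ⟪u (a₀ + s) x, convect (w (a₀ + s)) ⇑(stokesMode k a c) x⟫_ℝ)) * hmm
  -- assemble: `ρ ×` the modewise formula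
  have e2 : ⟪F.b i, F.T (ν * t) (z 0)⟫_ℝ =
      Real.exp (-(ν * t * F.m i)) * (ρ * ∫ x, ⟪w a₀ x, stokesMode k a c x⟫_ℝ) := by
    rw [hTi (ν * t) (mul_nonneg hν.le ht0) (z 0), hzi 0 ⟨le_rfl, ht0.trans ht.2⟩, add_zero]
  have e4 : ⟪F.b i, ∫ s in (0 : ℝ)..t, F.K (ν * (t - s)) (F.Nb (y s) (z s) + F.Nb (z s) (y s))⟫_ℝ =
      -ρ * ∫ s in (0 : ℝ)..t, Real.exp (-(ν * (t - s) * F.m i)) *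
          ((∫ x, ⟪w (a₀ + s) x, convect (u (a₀ + s)) ⇑(stokesMode k a c) x⟫_ℝ) +
            ∫ x, ⟪u (a₀ + s) x, convect (w (a₀ + s)) ⇑(stokesMode k a c) x⟫_ℝ) := by
    rw [inner_intervalIntegral_eq_of_intervalIntegrable ht0 hI, intervalIntegral.integral_congr_ae hae,
      intervalIntegral.integral_const_mul]
  linear_combination hzi t ht - e2 + e4 + ρ * hD

/-! ## The conjugated linear mild identity -/

/-- **Tools stub L1 — THE CONJUGATED LINEAR MILD IDENTITY: a classical linearised trajectory, read in the frame `S`,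
solves the linear mild equation of block N (identification of the derivative of the model with the linear mild flow).**
Over a `ModelFrame` (mode basis `b`, frame `S = diag((1+m)^{-1/2})`, Stokes semigroup `T`, smoothing family `K`,
bilinear form `Nb` given through its coefficient formula), let `u` be a jointly smooth divergence-free mean-zero
background on `[a₀, a₀+τ'] × T³` with frame curve `y`, `S (y t) = [u(a₀+t)]`, and let `(w, q)` be a classical solution
of the linearised system `∂ₜw + (u·∇)w + (w·∇)u = νΔw − ∇q` (`IsLinearizedNSSolutionOn`) with frame curve `z`,
`S (z t) = [w(a₀+t)]`.  Then for `t ∈ [0, τ']`: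
`z t = T(νt) (z 0) − ∫₀ᵗ K(ν(t−s)) (Nb (y s) (z s) + Nb (z s) (y s)) ds` (first slot of `Nb` = advecting field:
`(u·∇)w ↔ Nb y z`, `(w·∇)u ↔ Nb z y`).  Proof: `y` and `z` are continuous on the window
(`ModelFrame.continuousOn_frameCurve`), so the symmetrised Duhamel integrand is Bochner integrable
(`ModelFrame.intervalIntegrable_linearisedDuhamelIntegrand`); along each `b i` the identity is
`ModelFrame.inner_basis_frameCurve_eq_inner_basis_linearisedMild` (the modewise linearised Duhamel formula weighted by
`(1 + m_i)^{1/2}`), and vectors with equal basis coefficients are equal (Constantin–Foias 1988, Ch. 14 (14.2)–(14.4);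
Henry 1981, §3.3). [cite: ConstantinFoiasNSE1988, Ch. 14 (14.2)–(14.4)] -/
theorem stub_conjugatedLinearisedMildIdentityTools (F : ModelFrame) {ν : ℝ} (hν : 0 < ν) {a₀ τ' : ℝ} (hτ' : 0 < τ')
    {u w : ℝ → (UnitAddTorus (Fin 3)) → (EuclideanSpace ℝ (Fin 3))} {q : ℝ → (UnitAddTorus (Fin 3)) → ℝ}
    (hu : IsSmoothSpaceTimeOn (Icc a₀ (a₀ + τ')) u) (hudiv : ∀ t ∈ Icc a₀ (a₀ + τ'), IsDivFree (u t))
    (humean : ∀ t ∈ Icc a₀ (a₀ + τ'), HasZeroMean (u t)) (hlin : IsLinearizedNSSolutionOn (Icc a₀ (a₀ + τ')) ν u w q)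
    (y : ℝ → Hsp) (hy : ∀ t ∈ Icc (0 : ℝ) τ', F.S (y t) = stateOf (u (a₀ + t)))
    (z : ℝ → Hsp) (hz : ∀ t ∈ Icc (0 : ℝ) τ', F.S (z t) = stateOf (w (a₀ + t))) :
    ∀ t ∈ Icc (0 : ℝ) τ', z t = F.T (ν * t) (z 0) -
      ∫ s in (0 : ℝ)..t, F.K (ν * (t - s)) (F.Nb (y s) (z s) + F.Nb (z s) (y s)) := by
  intro t ht
  -- both frame curves are continuous on the window, so the symmetrised Duhamel integrand is integrable on `[0, t]`
  have hyc : ContinuousOn y (Icc 0 τ') := F.continuousOn_frameCurve hτ' hu hudiv humean hy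
  have hzc : ContinuousOn z (Icc 0 τ') := F.continuousOn_frameCurve hτ' hlin.1 hlin.2.2.1 hlin.2.2.2.1 hz
  have hI : IntervalIntegrable (fun s => F.K (ν * (t - s)) (F.Nb (y s) (z s) + F.Nb (z s) (y s))) volume 0 t :=
    F.intervalIntegrable_linearisedDuhamelIntegrand hν hτ' hyc hzc ht
  -- vectors with the same coefficients along the Hilbert basis are equal
  refine F.b.repr.injective (lp.ext (funext fun i => ?_))
  simp only [HilbertBasis.repr_apply_apply, inner_sub_right]
  exact F.inner_basis_frameCurve_eq_inner_basis_linearisedMild hν hu hudiv humean hlin hy hz ht hI i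

end Summit.AnomalousDissipation.AnomalousDissipation.Theorems.DenseLoudDesignerForces.Ergodic

end
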